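import Summits.ValiantsHypothesis.ValiantsHypothesis.Theses.AnyonJets
import Summits.ValiantsHypothesis.ValiantsHypothesis.Theorems.FermionicJetPencilControlsHC
import Literature.Computability.AlgebraicComplexity.IMMInVPProofs
import Literature.Computability.AlgebraicComplexity.ArithCircuitProofs
import Literature.Computability.AlgebraicComplexity.ValiantClasses

/-!
# Birth skeleton — crux `UniformJetUpperBound` (item `stmt-ValiantsHypothesis-16739`), line `birth`

Route `route-ValiantsHypothesis-AnyonJets`, crux
`Summit.ValiantsHypothesis.ValiantsHypothesis.Theses.AnyonJets.UniformJetUpperBound`: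
if `VP_ℂ = VNP_ℂ` then the anyonic jets `J_(n,k) = Σ_σ sgn σ · C(inv σ, k) · x^σ` have complex
circuit complexity `≤ n^c` for all `n ≥ n₀` and ALL orders `k` (uniformly in `k`).

This is the route header's own planned layer-2 split (TWO-LAYER PLAN: `UniformJetUpperBound ⇐
PencilInVNP → InterpolationCost → UJUB`), with the interpolation-cost node already LANDED in the
tree (`FermionicJetPencilControlsHC.complexity_coeff_optionEquivLeft_le`: a `T`-coefficient of a
polynomial of `T`-degree `≤ d` costs `≤ (d+1)(L+1) + (d+1)`, Strassen 1973 / Bürgisser 2000 §2.1),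
so the two registered stubs are exactly the two remaining mathematical inputs:

* `stub_pencilVNP` (PencilInVNP, PROVABLE NOW, size M/L) — the inversion (Mahonian / anyonic)
  pencil with the coupling `q` an extra VARIABLE, `P_n(q;X) = Σ_σ q^(inv σ) ∏_i X_(σ i, i)` in the
  `n² + 1` variables `Option (Fin n × Fin n)` (`q = X none`), is a `VNP` family over `ℂ`
  (Valiant 1979 / Bürgisser 2000 Prop. 2.20: Boolean sum over position matrices `Z` of
  `recogniser(Z) · ∏_(t<t', i'<i) (1 + (q-1) Z_(t,i) Z_(t',i')) · ∏_t Σ_i Z_(t,i) X_(i,t)`, the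
  recogniser being BCS's `α β` of `HamiltonianCycleVNP.lean` (`sum_recogniser_mul`); pattern:
  `ValiantConjectureProofs.lean` (per ∈ VNP), `FermionicJetJetsInVNP.lean` (cycle jets ∈ VNP)).
* `stub_jetTaylor` (Taylor expansion at the fermion point, PROVABLE NOW, size M) — writing
  `u = q + 1`, the polynomial `F_n(u;X) = P_n(u-1;X) = Σ_σ (u-1)^(inv σ) x^σ` has `u`-degree
  `≤ n(n-1)/2` and `(-1)^k [u^k] F_n = J_(n,k)` (mapped to `ℂ`), i.e. `P_n(-1+u;X) = Σ_k (-u)^k J_k`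
  (route text); ingredients: `sgn σ = (-1)^(inv σ)` (Mathlib `Equiv.Perm.signAux` is this product
  over `finPairsLT`), `Polynomial.coeff_X_sub_C_pow`-type binomial expansion, `inversionNumber_le`
  (`NilCoxeterTensor.lean`) for the degree.
* `UniformJetUpperBound_of : Registered.stub_pencilVNP → Registered.stub_jetTaylor →
  UniformJetUpperBound` — the composition, PROVED here sorry-free: `VP = VNP` and the bundling
  lemmas `mem_VNP_ofFintype_iff_holds` / `mem_VP_ofFintype_iff_holds` give `L(P_n) ≤ n^a + a`;
  the shift `q ↦ u - 1` costs one gate (`complexity_aeval_le`); interpolation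
  (`complexity_coeff_optionEquivLeft_le`, `d = n(n-1)/2`) and one scalar gate give
  `L(J_(n,k)) ≤ (d+1)(n^a + a + 3) + 1 ≤ n^(a+5)` for `n ≥ a + 3`, uniformly in `k`.

Disproof used: none exists (`ledger crux ls stmt-ValiantsHypothesis-16739` = no workfiles at
registration; no `_false_without_` theorem, no Negative lemma). Negatives index: nothing on the
inversion pencil / jets. Stub signatures are over Mathlib + `Literature.Computability.AlgebraicComplexity`
only (no new definitions), so provers can restate them verbatim in `Theorems/`.
-/

noncomputable section

-- single-conjunct layout: Sub = Summit, duplicated namespace component intended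
set_option linter.dupNamespace false

namespace Summit.ValiantsHypothesis.ValiantsHypothesis.Cruxes.UniformJetUpperBound.Birth

open MvPolynomial Literature.Computability.AlgebraicComplexity
open Summit.ValiantsHypothesis.ValiantsHypothesis.Theorems.FermionicJetPencilControlsHC

/-! ## The two stubs (registered obligations; signatures over existing declarations only) -/

/-- **PencilInVNP — THE INVERSION PENCIL WITH VARIABLE COUPLING IS p-DEFINABLE OVER `ℂ`** (stub,
named): the family `P_n = Σ_σ (X none)^(inv σ) · ∏_i X (some (σ i, i))` in the variables
`Option (Fin n × Fin n)` is a `VNP` family over `ℂ` (Bürgisser 2000, Def. 2.5: p-family + Boolean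
sum of a `VP` family). [provable-now: Valiant's criterion written out with BCS's permutation-matrix
recogniser (`sum_recogniser_mul`, HamiltonianCycleVNP.lean; templates ValiantConjectureProofs.lean,
Theorems/FermionicJetJetsInVNP.lean), or the multilinear lift `Σ_σ (∏_inversions y_p y_p') x^σ` by
`isVNPFamily_circuitSum` (ValiantCriterion.lean) + the projection `y ↦ q`
(`IsVNPFamily.of_isPProjection_holds`, VNPClosedUnderProjection.lean); Valiant1979, Burgisser2000
Prop. 2.20, BCS1997 Prop. (21.15), HungKuo2023 (the pencil)] -/
theorem stub_pencilVNP :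
    Literature.Computability.AlgebraicComplexity.IsVNPFamily (k := ℂ)
      (σ := fun n => Option (Fin n × Fin n))
      (fun n => ∑ σ : Equiv.Perm (Fin n),
        (MvPolynomial.X none : MvPolynomial (Option (Fin n × Fin n)) ℂ) ^
            (Finset.univ.filter (fun p : Fin n × Fin n => p.1 < p.2 ∧ σ p.2 < σ p.1)).card *
          ∏ i : Fin n, MvPolynomial.X (some (σ i, i))) := by
  sorry

/-- **JetTaylor — THE JETS ARE THE TAYLOR COEFFICIENTS OF THE PENCIL AT THE FERMION POINT**
(stub, named): with `u = q + 1`, `F_n(u;X) = Σ_σ (X none - 1)^(inv σ) · ∏_i X (some (σ i, i))`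
has `u`-degree `≤ n(n-1)/2` and `J_(n,k) ⊗ ℂ = (-1)^k · [u^k] F_n` for every `k`
(`P_n(-1+u;X) = Σ_k (-u)^k J_(n,k)`; `sgn σ = (-1)^(inv σ)` and the binomial theorem).
[provable-now; Valiant1979 (jets of the route), BjornerBrenti2005 Prop. 1.5.2 (inversions =
Coxeter length, sign), Burgisser2000 §2.1] -/
theorem stub_jetTaylor :
    ∀ n : ℕ,
      (MvPolynomial.optionEquivLeft ℂ (Fin n × Fin n)
          (∑ σ : Equiv.Perm (Fin n),
            ((MvPolynomial.X none : MvPolynomial (Option (Fin n × Fin n)) ℂ) - 1) ^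
                (Finset.univ.filter (fun p : Fin n × Fin n => p.1 < p.2 ∧ σ p.2 < σ p.1)).card *
              ∏ i : Fin n, MvPolynomial.X (some (σ i, i)))).natDegree ≤ n * (n - 1) / 2 ∧
      ∀ k : ℕ,
        MvPolynomial.map (Int.castRingHom ℂ)
            (∑ σ : Equiv.Perm (Fin n), MvPolynomial.C (((Equiv.Perm.sign σ : ℤˣ) : ℤ) *
                (((Finset.univ.filter (fun p : Fin n × Fin n => p.1 < p.2 ∧ σ p.2 < σ p.1)).card.choose k : ℕ) : ℤ)) *
              ∏ i : Fin n, MvPolynomial.X (σ i, i) : MvPolynomial (Fin n × Fin n) ℤ) =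
          (-1 : ℂ) ^ k •
            (MvPolynomial.optionEquivLeft ℂ (Fin n × Fin n)
              (∑ σ : Equiv.Perm (Fin n),
                ((MvPolynomial.X none : MvPolynomial (Option (Fin n × Fin n)) ℂ) - 1) ^
                    (Finset.univ.filter (fun p : Fin n × Fin n => p.1 < p.2 ∧ σ p.2 < σ p.1)).card *
                  ∏ i : Fin n, MvPolynomial.X (some (σ i, i)))).coeff k := by
  sorry

/-! ## Name-keyed aliases of the two stub statements (hypotheses of the composition)

`Registered.stub_X` is the statement of `stub_X` under the registered stub's short name, so that the
native skeleton audit (`#h21_check_skeleton`: hypotheses admissible iff registered obligations /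
declared stubs BY NAME) accepts `UniformJetUpperBound_of : Registered.stub_… → Registered.stub_… →
UniformJetUpperBound` (device of `Cruxes/RestorationQP/Lines/birth.lean`,
`Cruxes/ClassTransfer/Lines/birth.lean`). -/
namespace Registered

/-- Alias of the signature of `stub_pencilVNP` (verbatim). -/
abbrev stub_pencilVNP : Prop :=
  Literature.Computability.AlgebraicComplexity.IsVNPFamily (k := ℂ)
    (σ := fun n => Option (Fin n × Fin n))
    (fun n => ∑ σ : Equiv.Perm (Fin n),
      (MvPolynomial.X none : MvPolynomial (Option (Fin n × Fin n)) ℂ) ^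
          (Finset.univ.filter (fun p : Fin n × Fin n => p.1 < p.2 ∧ σ p.2 < σ p.1)).card *
        ∏ i : Fin n, MvPolynomial.X (some (σ i, i)))

/-- Alias of the signature of `stub_jetTaylor` (verbatim). -/
abbrev stub_jetTaylor : Prop :=
  ∀ n : ℕ,
    (MvPolynomial.optionEquivLeft ℂ (Fin n × Fin n)
        (∑ σ : Equiv.Perm (Fin n),
          ((MvPolynomial.X none : MvPolynomial (Option (Fin n × Fin n)) ℂ) - 1) ^
              (Finset.univ.filter (fun p : Fin n × Fin n => p.1 < p.2 ∧ σ p.2 < σ p.1)).card *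
            ∏ i : Fin n, MvPolynomial.X (some (σ i, i)))).natDegree ≤ n * (n - 1) / 2 ∧
    ∀ k : ℕ,
      MvPolynomial.map (Int.castRingHom ℂ)
          (∑ σ : Equiv.Perm (Fin n), MvPolynomial.C (((Equiv.Perm.sign σ : ℤˣ) : ℤ) *
              (((Finset.univ.filter (fun p : Fin n × Fin n => p.1 < p.2 ∧ σ p.2 < σ p.1)).card.choose k : ℕ) : ℤ)) *
            ∏ i : Fin n, MvPolynomial.X (σ i, i) : MvPolynomial (Fin n × Fin n) ℤ) =
        (-1 : ℂ) ^ k •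
          (MvPolynomial.optionEquivLeft ℂ (Fin n × Fin n)
            (∑ σ : Equiv.Perm (Fin n),
              ((MvPolynomial.X none : MvPolynomial (Option (Fin n × Fin n)) ℂ) - 1) ^
                  (Finset.univ.filter (fun p : Fin n × Fin n => p.1 < p.2 ∧ σ p.2 < σ p.1)).card *
                ∏ i : Fin n, MvPolynomial.X (some (σ i, i)))).coeff k

end Registered

/-! ## The composition (kernel-checked glue of the line) -/

/-- The inversion pencil family of `stub_pencilVNP` (proof-local abbreviation; not part of any stub
signature). [cite: HungKuo2023; Valiant1979] -/
def pencilFam : ∀ n : ℕ, MvPolynomial (Option (Fin n × Fin n)) ℂ :=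
  fun n => ∑ σ : Equiv.Perm (Fin n),
    (MvPolynomial.X none : MvPolynomial (Option (Fin n × Fin n)) ℂ) ^
        (Finset.univ.filter (fun p : Fin n × Fin n => p.1 < p.2 ∧ σ p.2 < σ p.1)).card *
      ∏ i : Fin n, MvPolynomial.X (some (σ i, i))

/-- **The shift to the fermion point costs one gate**: `F_n = P_n(q ↦ u - 1)` is a substitution
(`complexity_aeval_le`, Bürgisser 2000 Rem. 2.7) in which only `X none ↦ X none - 1` costs a gate. -/
theorem complexity_shift_le (n : ℕ) :
    complexity (∑ σ : Equiv.Perm (Fin n),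
        ((MvPolynomial.X none : MvPolynomial (Option (Fin n × Fin n)) ℂ) - 1) ^
            (Finset.univ.filter (fun p : Fin n × Fin n => p.1 < p.2 ∧ σ p.2 < σ p.1)).card *
          ∏ i : Fin n, MvPolynomial.X (some (σ i, i))) ≤ complexity (pencilFam n) + 1 := by
  set g : Option (Fin n × Fin n) → MvPolynomial (Option (Fin n × Fin n)) ℂ :=
    fun o => o.elim ((X none : MvPolynomial (Option (Fin n × Fin n)) ℂ) - 1) (fun p => X (some p))
    with hg
  have heval : aeval g (pencilFam n) = ∑ σ : Equiv.Perm (Fin n),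
      ((MvPolynomial.X none : MvPolynomial (Option (Fin n × Fin n)) ℂ) - 1) ^
          (Finset.univ.filter (fun p : Fin n × Fin n => p.1 < p.2 ∧ σ p.2 < σ p.1)).card *
        ∏ i : Fin n, MvPolynomial.X (some (σ i, i)) := by
    simp only [pencilFam, hg, map_sum, map_mul, map_pow, map_prod, aeval_X, Option.elim_none,
      Option.elim_some]
  rw [← heval]
  refine (complexity_aeval_le _ _).trans (Nat.add_le_add_left ?_ _)
  rw [Fintype.sum_option]
  have h0 : ∑ p : Fin n × Fin n, complexity (g (some p)) = 0 :=
    Finset.sum_eq_zero fun p _ => by simp only [hg, Option.elim_some]; exact complexity_X_holds _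
  have h1 : complexity (g none) ≤ 1 := by
    have h := complexity_add_le_holds (X none : MvPolynomial (Option (Fin n × Fin n)) ℂ) (C (-1))
    rw [complexity_X_holds, complexity_C_holds] at h
    have e : (X none : MvPolynomial (Option (Fin n × Fin n)) ℂ) + C (-1) = X none - 1 := by
      rw [map_neg, map_one, ← sub_eq_add_neg]
    rw [e] at h
    simpa only [hg, Option.elim_none, zero_add] using h
  omega

/-- **Growth bookkeeping**: `(n(n-1)/2 + 1)(n^a + a + 3) + 1 ≤ n^(a+5)` for `n ≥ a + 3`. [folklore] -/
theorem growth_bound (a n : ℕ) (hn : a + 3 ≤ n) :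
    (n * (n - 1) / 2 + 1) * (n ^ a + a + 3) + 1 ≤ n ^ (a + 5) := by
  have hn1 : 1 ≤ n := by omega
  have hn2 : 2 ≤ n := by omega
  have hd1 : n * (n - 1) / 2 + 1 ≤ n * n := by
    have h1 : n * (n - 1) / 2 ≤ n * (n - 1) := Nat.div_le_self _ _
    have h2 : n * (n - 1) = n * n - n := Nat.mul_sub_one n n
    have h3 : n ≤ n * n := Nat.le_mul_self n
    omega
  have hA : n ^ a + a + 3 ≤ n ^ (a + 2) := by
    have h1 : n ≤ n ^ (a + 1) := by
      calc n = n ^ 1 := (pow_one n).symm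
        _ ≤ n ^ (a + 1) := Nat.pow_le_pow_right hn1 (by omega)
    have h2 : n ^ a ≤ n ^ (a + 1) := Nat.pow_le_pow_right hn1 (by omega)
    have h3 : 2 * n ^ (a + 1) ≤ n ^ (a + 2) := by
      calc 2 * n ^ (a + 1) ≤ n * n ^ (a + 1) := Nat.mul_le_mul_right _ hn2
        _ = n ^ (a + 2) := by ring
    omega
  have h4 : 1 ≤ n ^ (a + 4) := Nat.one_le_pow _ _ hn1
  calc (n * (n - 1) / 2 + 1) * (n ^ a + a + 3) + 1 ≤ n * n * n ^ (a + 2) + 1 :=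
        Nat.add_le_add_right (Nat.mul_le_mul hd1 hA) 1
    _ = n ^ (a + 4) + 1 := by ring
    _ ≤ n ^ (a + 4) + n ^ (a + 4) := Nat.add_le_add_left h4 _
    _ = 2 * n ^ (a + 4) := by ring
    _ ≤ n * n ^ (a + 4) := Nat.mul_le_mul_right _ hn2
    _ = n ^ (a + 5) := by ring

/-- **Composition** (the glue of the line, kernel-checked, no `sorry`): `VP_ℂ = VNP_ℂ` and
PencilInVNP put the pencil in `VP` (`L(P_n) ≤ n^a + a`, via the bundling lemmas
`mem_VNP_ofFintype_iff_holds` / `mem_VP_ofFintype_iff_holds`); the fermion-point shift costs one gate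
(`complexity_shift_le`); JetTaylor identifies `J_(n,k) ⊗ ℂ` with `(-1)^k [u^k] F_n` where `F_n` has
`u`-degree `≤ n(n-1)/2`, so the landed interpolation bound `complexity_coeff_optionEquivLeft_le` and
one scalar gate give `L(J_(n,k)) ≤ (n(n-1)/2 + 1)(n^a + a + 3) + 1 ≤ n^(a+5)` for `n ≥ a + 3`,
uniformly in `k`. [Valiant1979; Strassen1973; Burgisser2000 §2.1, Prop. 2.20] -/
theorem UniformJetUpperBound_of :
    Registered.stub_pencilVNP → Registered.stub_jetTaylor →
      Summit.ValiantsHypothesis.ValiantsHypothesis.Theses.AnyonJets.UniformJetUpperBound := by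
  intro hP hT
  dsimp only [Summit.ValiantsHypothesis.ValiantsHypothesis.Theses.AnyonJets.UniformJetUpperBound]
  intro hEq
  -- the pencil is a VP family
  have hfam : IsVNPFamily (k := ℂ) (σ := fun n => Option (Fin n × Fin n)) pencilFam := hP
  have hmem : PolyFamily.ofFintype pencilFam ∈ VNP ℂ :=
    (mem_VNP_ofFintype_iff_holds (k := ℂ) (σ := fun n => Option (Fin n × Fin n)) pencilFam).2 hfam
  rw [← hEq] at hmem
  have hVP : IsVPFamily (k := ℂ) (σ := fun n => Option (Fin n × Fin n)) pencilFam :=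
    (mem_VP_ofFintype_iff_holds (k := ℂ) (σ := fun n => Option (Fin n × Fin n)) pencilFam).1 hmem
  obtain ⟨a, ha⟩ := hVP.2
  refine ⟨a + 5, a + 3, fun n hn k => ?_⟩
  have hPn : complexity (pencilFam n) ≤ n ^ a + a := ha n
  obtain ⟨hd, hJ⟩ := hT n
  rw [hJ k]
  refine (complexity_smul_le_holds _ _).trans ?_
  have hcoeff := complexity_coeff_optionEquivLeft_le _ hd k
  have hF := complexity_shift_le n
  refine (Nat.add_le_add_right hcoeff 1).trans ?_
  refine le_trans ?_ (growth_bound a n hn)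
  have h1 := Nat.mul_le_mul_left (n * (n - 1) / 2 + 1)
    (show complexity (∑ σ : Equiv.Perm (Fin n),
        ((MvPolynomial.X none : MvPolynomial (Option (Fin n × Fin n)) ℂ) - 1) ^
            (Finset.univ.filter (fun p : Fin n × Fin n => p.1 < p.2 ∧ σ p.2 < σ p.1)).card *
          ∏ i : Fin n, MvPolynomial.X (some (σ i, i))) + 2 ≤ n ^ a + a + 3 by omega)
  have h2 : (n * (n - 1) / 2 + 1) * (complexity (∑ σ : Equiv.Perm (Fin n),
        ((MvPolynomial.X none : MvPolynomial (Option (Fin n × Fin n)) ℂ) - 1) ^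
            (Finset.univ.filter (fun p : Fin n × Fin n => p.1 < p.2 ∧ σ p.2 < σ p.1)).card *
          ∏ i : Fin n, MvPolynomial.X (some (σ i, i))) + 1) + (n * (n - 1) / 2 + 1) + 1 =
      (n * (n - 1) / 2 + 1) * (complexity (∑ σ : Equiv.Perm (Fin n),
        ((MvPolynomial.X none : MvPolynomial (Option (Fin n × Fin n)) ℂ) - 1) ^
            (Finset.univ.filter (fun p : Fin n × Fin n => p.1 < p.2 ∧ σ p.2 < σ p.1)).card *
          ∏ i : Fin n, MvPolynomial.X (some (σ i, i))) + 2) + 1 := by ring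
  omega

/-- Wiring check: the registered stubs feed `UniformJetUpperBound_of` exactly as stated, so the
skeleton is `UniformJetUpperBound` closed modulo the two stubs (sorries enter only through them). -/
example : Summit.ValiantsHypothesis.ValiantsHypothesis.Theses.AnyonJets.UniformJetUpperBound :=
  UniformJetUpperBound_of stub_pencilVNP stub_jetTaylor

end Summit.ValiantsHypothesis.ValiantsHypothesis.Cruxes.UniformJetUpperBound.Birth
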